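import Summits.QuantumFields.YangMills.Theorems.ColdStartUniversalityColdStartSolutionsExistVecPicardEstimates
import HarnessLib

/-!
# Route `ColdStartUniversality`, support item S (stmt-QuantumFields-24811), line `piwiener`:
# vector Picard iteration III — invariance of the step, factorial and geometric bounds, Borel–Cantelli

Helper file (lead `ym-line-csu-p1`) for stub A `stub_ambientStrongExistence`; port of
`picardInv_picardStep`, `picardDist_le`, `picardDist_zero_lt_top`, `picardDist_le_geometric`,
`ae_eventually_iSup_picard_lt` of the tree's 1-D `Literature/Analysis/FunctionSpaces/ItoProcessesProofs.lean`
(Revuz–Yor IX (2.1), existence half) to Lipschitz systems driven by a Brownian vector (parts I–II: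
`…VecPicardStep`, `…VecPicardEstimates`).  A PICARD SEQUENCE is a sequence of vector processes
`X m : ι → ℝ≥0 → Ω → ℝ` with Itô integrals `JX m i n`, `X 0 ≡ x₀`, every `X m` coordinatewise progressive
with a.s. continuous paths, and `X (m+1) = x₀ + ∫ b(X m) ds + Σₙ JX m · n` (hypotheses spelled out; no
definition is introduced).

* `vecPicard_step_sqIntegrable` — the step of an invariant process is again `L²(sup)`;
* `vecPicard_dist_le` — `Φ_t(Xᵐ, Xᵐ⁺¹) ≤ Φ_T(X⁰, X¹) Cᵐ tᵐ/m!` (`t ≤ T`), `vecPicard_dist_zero_lt_top`;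
* `vecPicard_dist_le_geometric` — `Φ_T(Xᵐ, Xᵐ⁺¹) ≤ D e^{16cT} 16⁻ᵐ`;
* `vecPicard_ae_eventually_iSup_lt` — a.s., for every `T ∈ ℕ`, eventually
  `sup_{s≤T} Σ_i (Xᵐ_i − Xᵐ⁺¹_i)²(s) < 4⁻ᵐ` (Markov + Borel–Cantelli).

No definition, no sorry.  RECORD-rung plumbing; nothing here bears on the Yang–Mills mass gap. -/

set_option autoImplicit false

noncomputable section

namespace Summit.QuantumFields.YangMills.Theorems.ColdStartUniversality

open MeasureTheory ProbabilityTheory Filter Topology Finset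
open scoped NNReal ENNReal BigOperators
open Literature.Probability.Process Literature.Analysis.FunctionSpaces

variable {Ω : Type*} {mΩ : MeasurableSpace Ω} {P : Measure Ω} {d : ℕ}
  {W : ℝ≥0 → Ω → (Fin d → ℝ)} {ι κ : Type*} [Fintype ι] [Fintype κ]
  {b : (ι → ℝ) → ι → ℝ} {σ : (ι → ℝ) → ι → κ → ℝ} {c : ι → κ → Fin d} {K : ℝ} {x₀ : ι → ℝ}

/-- **The Picard step preserves square integrability of the running supremum**:
`E[sup_{s≤t} Σ_i (SU)_i(s)²] < ∞` (`SU = x₀ + (SU − Sx₀) + (Sx₀ − x₀)`, contraction against the step of the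
constant process, `vecPicard_const_step_lt_top`). Port of `picardInv_picardStep`. [folklore] -/
theorem vecPicard_step_sqIntegrable [IsProbabilityMeasure P] (hW : IsBrownianVec W P) (hK : 0 ≤ K)
    (hb : ∀ x y : ι → ℝ, ∑ i, (b x i - b y i) ^ 2 ≤ K * ∑ i, (x i - y i) ^ 2)
    (hσ : ∀ x y : ι → ℝ, ∑ i, ∑ n, (σ x i n - σ y i n) ^ 2 ≤ K * ∑ i, (x i - y i) ^ 2)
    {U V : ι → ℝ≥0 → Ω → ℝ} {JV : ι → κ → ℝ≥0 → Ω → ℝ}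
    (hU : ∀ i, IsStronglyProgressive hW.natFiltration (U i)) (hUc : ∀ᵐ ω ∂P, ∀ i, Continuous fun t => U i t ω)
    (hU2 : ∀ t : ℝ≥0, ∫⁻ ω, ⨆ s ∈ Set.Iic t, ENNReal.ofReal (∑ i, U i s ω ^ 2) ∂P < ∞)
    (hJV : ∀ i n, IsItoIntegral (fun s ω => σ (fun j => U j s ω) i n) (fun s ω => W s ω (c i n)) (JV i n)
        hW.natFiltration P ∧ IsStronglyProgressive hW.natFiltration (JV i n))
    (hV : ∀ i t ω, V i t ω = x₀ i + timeIntegral (fun s ω => b (fun j => U j s ω) i) t ω + ∑ n, JV i n t ω)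
    (t : ℝ≥0) :
    ∫⁻ ω, ⨆ s ∈ Set.Iic t, ENNReal.ofReal (∑ i, V i s ω ^ 2) ∂P < ∞ := by
  obtain ⟨hCp, hCc, hC2⟩ := vecPicard_inv_const (P := P) hW x₀
  obtain ⟨V0, JV0, hJV0, hV0⟩ := vecPicard_step_exists (b := b) hW c hK hσ x₀ hCp hC2
  have hJV0' : ∀ i n, IsItoIntegral (fun s ω => σ (fun j => (fun i (_ : ℝ≥0) (_ : Ω) => x₀ i) j s ω) i n)
      (fun s ω => W s ω (c i n)) (JV0 i n) hW.natFiltration P ∧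
      IsStronglyProgressive hW.natFiltration (JV0 i n) := fun i n => ⟨(hJV0 i n).1, (hJV0 i n).2.2.2.1⟩
  have h1 := vecPicard_contraction hW hK hb hσ hU hUc hCp hCc hJV hV hJV0' hV0 t t le_rfl
  have h2 := vecPicard_const_step_lt_top (x₀ := x₀) hW hK hσ (U := fun i _ _ => x₀ i) (fun _ _ _ => rfl)
    hJV0' hV0 t
  have hVp := vecPicard_step_progressive hW hK hb hU (fun i n => (hJV i n).2) hV
  have hVc := vecPicard_step_continuous hW hK hb hUc (fun i n => (hJV i n).1) hV
  have hV0p := vecPicard_step_progressive hW hK hb hCp (fun i n => (hJV0' i n).2) hV0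
  have hV0c := vecPicard_step_continuous hW hK hb hCc (fun i n => (hJV0' i n).1) hV0
  -- pointwise decomposition `V = x₀ + (V - V0) + (V0 - x₀)`
  have hpt : ∀ ω, ⨆ s ∈ Set.Iic t, ENNReal.ofReal (∑ i, V i s ω ^ 2) ≤
      3 * ENNReal.ofReal (∑ i, x₀ i ^ 2) +
      3 * (⨆ s ∈ Set.Iic t, ENNReal.ofReal (∑ i, (V i s ω - V0 i s ω) ^ 2)) +
      3 * ⨆ s ∈ Set.Iic t, ENNReal.ofReal (∑ i, (x₀ i - V0 i s ω) ^ 2) := by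
    intro ω
    refine iSup₂_le fun s hs => ?_
    have hle : ∑ i, V i s ω ^ 2 ≤ 3 * ∑ i, x₀ i ^ 2 + 3 * ∑ i, (V i s ω - V0 i s ω) ^ 2 +
        3 * ∑ i, (x₀ i - V0 i s ω) ^ 2 := by
      rw [Finset.mul_sum, Finset.mul_sum, Finset.mul_sum, ← Finset.sum_add_distrib, ← Finset.sum_add_distrib]
      refine Finset.sum_le_sum fun i _ => ?_
      nlinarith [sq_nonneg (x₀ i - (V i s ω - V0 i s ω)), sq_nonneg (x₀ i + (x₀ i - V0 i s ω)),
        sq_nonneg ((V i s ω - V0 i s ω) + (x₀ i - V0 i s ω))]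
    calc ENNReal.ofReal (∑ i, V i s ω ^ 2)
        ≤ ENNReal.ofReal (3 * ∑ i, x₀ i ^ 2 + 3 * ∑ i, (V i s ω - V0 i s ω) ^ 2 +
            3 * ∑ i, (x₀ i - V0 i s ω) ^ 2) := ENNReal.ofReal_le_ofReal hle
      _ = 3 * ENNReal.ofReal (∑ i, x₀ i ^ 2) + 3 * ENNReal.ofReal (∑ i, (V i s ω - V0 i s ω) ^ 2) +
            3 * ENNReal.ofReal (∑ i, (x₀ i - V0 i s ω) ^ 2) := by
          rw [ENNReal.ofReal_add (by positivity) (by positivity), ENNReal.ofReal_add (by positivity) (by positivity),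
            ENNReal.ofReal_mul (by norm_num), ENNReal.ofReal_mul (by norm_num), ENNReal.ofReal_mul (by norm_num),
            ENNReal.ofReal_ofNat]
      _ ≤ _ := by
          gcongr
          · exact le_iSup₂_of_le s hs le_rfl
          · exact le_iSup₂_of_le s hs le_rfl
  -- the contraction bound is finite
  have h1' : ∫⁻ ω, ⨆ s ∈ Set.Iic t, ENNReal.ofReal (∑ i, (V i s ω - V0 i s ω) ^ 2) ∂P < ∞ := by
    refine lt_of_le_of_lt h1 (ENNReal.mul_lt_top ?_ ?_)
    · refine ENNReal.add_lt_top.2 ⟨ENNReal.mul_lt_top (by simp) ENNReal.ofReal_lt_top, ?_⟩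
      exact ENNReal.mul_lt_top (ENNReal.mul_lt_top (ENNReal.mul_lt_top (by norm_num) (by simp))
        (ENNReal.pow_lt_top (by simp))) ENNReal.ofReal_lt_top
    have hin : ∀ ω, ∫⁻ r in Set.Icc (0 : ℝ) t, ENNReal.ofReal
        (∑ i, (U i r.toNNReal ω - (fun i (_ : ℝ≥0) (_ : Ω) => x₀ i) i r.toNNReal ω) ^ 2) ≤
        (2 * ENNReal.ofReal (∑ i, x₀ i ^ 2) + 2 * ⨆ s ∈ Set.Iic t, ENNReal.ofReal (∑ i, U i s ω ^ 2)) *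
          volume (Set.Icc (0 : ℝ) t) := by
      intro ω
      rw [← setLIntegral_const]
      refine setLIntegral_mono' measurableSet_Icc fun r hr => ?_
      have hrt : r.toNNReal ∈ Set.Iic t := Real.toNNReal_le_iff_le_coe.2 hr.2
      have hle : ∑ i, (U i r.toNNReal ω - x₀ i) ^ 2 ≤ 2 * ∑ i, x₀ i ^ 2 + 2 * ∑ i, U i r.toNNReal ω ^ 2 := by
        rw [Finset.mul_sum, Finset.mul_sum, ← Finset.sum_add_distrib]
        exact Finset.sum_le_sum fun i _ => by nlinarith [sq_nonneg (U i r.toNNReal ω + x₀ i)]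
      calc ENNReal.ofReal (∑ i, (U i r.toNNReal ω - x₀ i) ^ 2)
          ≤ ENNReal.ofReal (2 * ∑ i, x₀ i ^ 2 + 2 * ∑ i, U i r.toNNReal ω ^ 2) := ENNReal.ofReal_le_ofReal hle
        _ = 2 * ENNReal.ofReal (∑ i, x₀ i ^ 2) + 2 * ENNReal.ofReal (∑ i, U i r.toNNReal ω ^ 2) := by
            rw [ENNReal.ofReal_add (by positivity) (by positivity), ENNReal.ofReal_mul (by norm_num),
              ENNReal.ofReal_mul (by norm_num), ENNReal.ofReal_ofNat]
        _ ≤ _ := by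
            gcongr
            exact le_iSup₂_of_le r.toNNReal hrt le_rfl
    calc ∫⁻ ω, (∫⁻ r in Set.Icc (0 : ℝ) t, ENNReal.ofReal
          (∑ i, (U i r.toNNReal ω - (fun i (_ : ℝ≥0) (_ : Ω) => x₀ i) i r.toNNReal ω) ^ 2)) ∂P
        ≤ ∫⁻ ω, (2 * ENNReal.ofReal (∑ i, x₀ i ^ 2) + 2 * ⨆ s ∈ Set.Iic t, ENNReal.ofReal (∑ i, U i s ω ^ 2)) *
            volume (Set.Icc (0 : ℝ) t) ∂P := lintegral_mono hin
      _ = (2 * ENNReal.ofReal (∑ i, x₀ i ^ 2) * P Set.univ +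
            2 * ∫⁻ ω, ⨆ s ∈ Set.Iic t, ENNReal.ofReal (∑ i, U i s ω ^ 2) ∂P) * volume (Set.Icc (0 : ℝ) t) := by
          rw [lintegral_mul_const' _ _ measure_Icc_lt_top.ne, lintegral_add_left measurable_const,
            lintegral_const, lintegral_const_mul' _ _ (by norm_num)]
      _ < ⊤ := by
          refine ENNReal.mul_lt_top (ENNReal.add_lt_top.2 ⟨?_, ?_⟩) measure_Icc_lt_top
          · exact ENNReal.mul_lt_top (ENNReal.mul_lt_top (by norm_num) ENNReal.ofReal_lt_top) (measure_lt_top _ _)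
          · exact ENNReal.mul_lt_top (by norm_num) (hU2 t)
  have hm : AEMeasurable (fun ω => 3 * ENNReal.ofReal (∑ i, x₀ i ^ 2) +
      3 * ⨆ s ∈ Set.Iic t, ENNReal.ofReal (∑ i, (V i s ω - V0 i s ω) ^ 2)) P :=
    aemeasurable_const.add ((vecPicard_aemeasurable_biSup hVp hV0p hVc hV0c t).const_mul _)
  calc ∫⁻ ω, ⨆ s ∈ Set.Iic t, ENNReal.ofReal (∑ i, V i s ω ^ 2) ∂P
      ≤ ∫⁻ ω, (3 * ENNReal.ofReal (∑ i, x₀ i ^ 2) +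
          3 * (⨆ s ∈ Set.Iic t, ENNReal.ofReal (∑ i, (V i s ω - V0 i s ω) ^ 2)) +
          3 * ⨆ s ∈ Set.Iic t, ENNReal.ofReal (∑ i, (x₀ i - V0 i s ω) ^ 2)) ∂P := lintegral_mono hpt
    _ = 3 * ENNReal.ofReal (∑ i, x₀ i ^ 2) * P Set.univ +
          3 * ∫⁻ ω, ⨆ s ∈ Set.Iic t, ENNReal.ofReal (∑ i, (V i s ω - V0 i s ω) ^ 2) ∂P +
          3 * ∫⁻ ω, ⨆ s ∈ Set.Iic t, ENNReal.ofReal (∑ i, (x₀ i - V0 i s ω) ^ 2) ∂P := by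
        rw [lintegral_add_left' hm, lintegral_add_left measurable_const, lintegral_const,
          lintegral_const_mul'' _ (vecPicard_aemeasurable_biSup hVp hV0p hVc hV0c t),
          lintegral_const_mul' _ _ (by norm_num)]
    _ < ⊤ := by
        refine ENNReal.add_lt_top.2 ⟨ENNReal.add_lt_top.2 ⟨?_, ?_⟩, ?_⟩
        · exact ENNReal.mul_lt_top (ENNReal.mul_lt_top (by norm_num) ENNReal.ofReal_lt_top) (measure_lt_top _ _)
        · exact ENNReal.mul_lt_top (by norm_num) h1'
        · exact ENNReal.mul_lt_top (by norm_num) h2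

/-- The contraction constant, read in `ℝ≥0∞`, is `ofReal` of the real constant. [folklore] -/
theorem vecPicard_const_eq (hK : 0 ≤ K) (T : ℝ≥0) :
    (Fintype.card ι : ℝ≥0∞) * ENNReal.ofReal (2 * T * K) +
        8 * (Fintype.card ι : ℝ≥0∞) * (Fintype.card κ : ℝ≥0∞) ^ 2 * ENNReal.ofReal K =
      ENNReal.ofReal ((Fintype.card ι : ℝ) * (2 * T * K) +
        8 * (Fintype.card ι : ℝ) * (Fintype.card κ : ℝ) ^ 2 * K) := by
  have h1 : (0 : ℝ) ≤ (Fintype.card ι : ℝ) * (2 * T * K) := by positivity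
  have h2 : (0 : ℝ) ≤ 8 * (Fintype.card ι : ℝ) * (Fintype.card κ : ℝ) ^ 2 * K := by positivity
  rw [ENNReal.ofReal_add h1 h2]
  congr 1
  · rw [ENNReal.ofReal_mul (Nat.cast_nonneg _), ENNReal.ofReal_natCast]
  · rw [ENNReal.ofReal_mul (by positivity : (0 : ℝ) ≤ 8 * (Fintype.card ι : ℝ) * (Fintype.card κ : ℝ) ^ 2),
      ENNReal.ofReal_mul (by positivity : (0 : ℝ) ≤ 8 * (Fintype.card ι : ℝ)),
      ENNReal.ofReal_mul (by norm_num : (0 : ℝ) ≤ 8), ENNReal.ofReal_pow (Nat.cast_nonneg _),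
      ENNReal.ofReal_natCast, ENNReal.ofReal_natCast, ENNReal.ofReal_ofNat]

section Sequence

variable [IsProbabilityMeasure P] (hW : IsBrownianVec W P) (hK : 0 ≤ K)
  (hb : ∀ x y : ι → ℝ, ∑ i, (b x i - b y i) ^ 2 ≤ K * ∑ i, (x i - y i) ^ 2)
  (hσ : ∀ x y : ι → ℝ, ∑ i, ∑ n, (σ x i n - σ y i n) ^ 2 ≤ K * ∑ i, (x i - y i) ^ 2)
  {X : ℕ → ι → ℝ≥0 → Ω → ℝ} {JX : ℕ → ι → κ → ℝ≥0 → Ω → ℝ}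
  (hX0 : ∀ i t ω, X 0 i t ω = x₀ i)
  (hXp : ∀ m i, IsStronglyProgressive hW.natFiltration (X m i))
  (hXc : ∀ m, ∀ᵐ ω ∂P, ∀ i, Continuous fun t => X m i t ω)
  (hJX : ∀ m i n, IsItoIntegral (fun s ω => σ (fun j => X m j s ω) i n) (fun s ω => W s ω (c i n)) (JX m i n)
      hW.natFiltration P ∧ IsStronglyProgressive hW.natFiltration (JX m i n))
  (hXs : ∀ m i t ω, X (m + 1) i t ω =
      x₀ i + timeIntegral (fun s ω => b (fun j => X m j s ω) i) t ω + ∑ n, JX m i n t ω)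

include hW hK hb hσ hX0 hXp hXc hJX hXs

omit hX0 in
/-- **The factorial bound** `Φ_t(Xᵐ, Xᵐ⁺¹) ≤ Φ_T(X⁰, X¹) Cᵐ tᵐ/m!` for `t ≤ T` along a Picard sequence
(contraction estimate + Tonelli, by induction). Port of `picardDist_le`.
Revuz–Yor (1999), Ch. IX, proof of Thm (2.1). [folklore] -/
theorem vecPicard_dist_le (T : ℝ≥0) (m : ℕ) :
    ∀ t ≤ T, ∫⁻ ω, ⨆ s ∈ Set.Iic t, ENNReal.ofReal (∑ i, (X m i s ω - X (m + 1) i s ω) ^ 2) ∂P ≤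
      (∫⁻ ω, ⨆ s ∈ Set.Iic T, ENNReal.ofReal (∑ i, (X 0 i s ω - X 1 i s ω) ^ 2) ∂P) *
        ((Fintype.card ι : ℝ≥0∞) * ENNReal.ofReal (2 * T * K) +
            8 * (Fintype.card ι : ℝ≥0∞) * (Fintype.card κ : ℝ≥0∞) ^ 2 * ENNReal.ofReal K) ^ m *
          ENNReal.ofReal ((t : ℝ) ^ m / m.factorial) := by
  induction m with
  | zero =>
    intro t ht
    simp only [pow_zero, Nat.factorial_zero, Nat.cast_one, div_one, ENNReal.ofReal_one, mul_one, zero_add]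
    exact lintegral_mono fun ω => biSup_mono fun s (hs : s ∈ Set.Iic t) => Set.mem_Iic.2 (hs.trans ht)
  | succ m ih =>
    intro t ht
    have h1 := vecPicard_contraction hW hK hb hσ (hXp m) (hXc m) (hXp (m + 1)) (hXc (m + 1)) (hJX m) (hXs m)
      (hJX (m + 1)) (hXs (m + 1)) T t ht
    have hmeas : Measurable (fun q : Ω × ℝ => ENNReal.ofReal
        (∑ i, (X m i q.2.toNNReal q.1 - X (m + 1) i q.2.toNNReal q.1) ^ 2)) := by
      have hu := IsStronglyProgressive.measurable_uncurry
        (vecPicard_isStronglyProgressive_sumSq (hXp m) (hXp (m + 1)))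
      exact (hu.comp ((measurable_real_toNNReal.comp measurable_snd).prodMk measurable_fst)).ennreal_ofReal
    have h2 : ∫⁻ ω, (∫⁻ r in Set.Icc (0 : ℝ) t, ENNReal.ofReal
        (∑ i, (X m i r.toNNReal ω - X (m + 1) i r.toNNReal ω) ^ 2)) ∂P ≤
        ∫⁻ r in Set.Icc (0 : ℝ) t, (∫⁻ ω, ⨆ s ∈ Set.Iic T, ENNReal.ofReal (∑ i, (X 0 i s ω - X 1 i s ω) ^ 2) ∂P) *
          ((Fintype.card ι : ℝ≥0∞) * ENNReal.ofReal (2 * T * K) +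
              8 * (Fintype.card ι : ℝ≥0∞) * (Fintype.card κ : ℝ≥0∞) ^ 2 * ENNReal.ofReal K) ^ m *
            ENNReal.ofReal (r ^ m / m.factorial) := by
      rw [lintegral_lintegral_swap hmeas.aemeasurable]
      refine setLIntegral_mono' measurableSet_Icc fun r hr => ?_
      have hr' : r.toNNReal ≤ T := (Real.toNNReal_le_iff_le_coe.2 hr.2).trans ht
      refine (lintegral_mono fun ω => ?_).trans ((ih _ hr').trans_eq ?_)
      · exact le_iSup₂_of_le r.toNNReal (Set.mem_Iic.2 le_rfl) le_rfl
      · rw [Real.coe_toNNReal _ hr.1]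
    have hmeas2 : Measurable (fun r : ℝ => ENNReal.ofReal (r ^ m / m.factorial)) :=
      ((measurable_id.pow_const m).div_const _).ennreal_ofReal
    calc ∫⁻ ω, ⨆ s ∈ Set.Iic t, ENNReal.ofReal (∑ i, (X (m + 1) i s ω - X (m + 1 + 1) i s ω) ^ 2) ∂P
        ≤ _ := h1
      _ ≤ ((Fintype.card ι : ℝ≥0∞) * ENNReal.ofReal (2 * T * K) +
              8 * (Fintype.card ι : ℝ≥0∞) * (Fintype.card κ : ℝ≥0∞) ^ 2 * ENNReal.ofReal K) *
            ∫⁻ r in Set.Icc (0 : ℝ) t,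
              (∫⁻ ω, ⨆ s ∈ Set.Iic T, ENNReal.ofReal (∑ i, (X 0 i s ω - X 1 i s ω) ^ 2) ∂P) *
              ((Fintype.card ι : ℝ≥0∞) * ENNReal.ofReal (2 * T * K) +
                  8 * (Fintype.card ι : ℝ≥0∞) * (Fintype.card κ : ℝ≥0∞) ^ 2 * ENNReal.ofReal K) ^ m *
                ENNReal.ofReal (r ^ m / m.factorial) := by gcongr
      _ = _ := by
          rw [lintegral_const_mul _ hmeas2, lintegral_Icc_pow_div_factorial, pow_succ]
          ring

omit hb hXp hXc in
/-- **Finiteness of `D = Φ_T(X⁰, X¹)`** along a Picard sequence. Port of `picardDist_zero_lt_top`. [folklore] -/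
theorem vecPicard_dist_zero_lt_top (T : ℝ≥0) :
    ∫⁻ ω, ⨆ s ∈ Set.Iic T, ENNReal.ofReal (∑ i, (X 0 i s ω - X 1 i s ω) ^ 2) ∂P < ∞ := by
  have h := vecPicard_const_step_lt_top (x₀ := x₀) hW hK hσ (U := X 0) (V := X 1) (JV := JX 0) hX0 (hJX 0)
    (hXs 0) T
  have heq : ∀ ω, (⨆ s ∈ Set.Iic T, ENNReal.ofReal (∑ i, (X 0 i s ω - X 1 i s ω) ^ 2)) =
      ⨆ s ∈ Set.Iic T, ENNReal.ofReal (∑ i, (x₀ i - X 1 i s ω) ^ 2) := by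
    intro ω; simp only [hX0]
  simp_rw [heq]
  exact h

omit hX0 in
/-- **Geometric decay of the Picard increments**: `Φ_T(Xᵐ, Xᵐ⁺¹) ≤ D e^{16cT} 16⁻ᵐ`. Port of
`picardDist_le_geometric`. [folklore] -/
theorem vecPicard_dist_le_geometric (T : ℝ≥0) (m : ℕ) :
    ∫⁻ ω, ⨆ s ∈ Set.Iic T, ENNReal.ofReal (∑ i, (X m i s ω - X (m + 1) i s ω) ^ 2) ∂P ≤
      (∫⁻ ω, ⨆ s ∈ Set.Iic T, ENNReal.ofReal (∑ i, (X 0 i s ω - X 1 i s ω) ^ 2) ∂P) *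
        ENNReal.ofReal (Real.exp (16 * (((Fintype.card ι : ℝ) * (2 * T * K) +
          8 * (Fintype.card ι : ℝ) * (Fintype.card κ : ℝ) ^ 2 * K) * T))) * (1 / 16) ^ m := by
  set cc : ℝ := (Fintype.card ι : ℝ) * (2 * T * K) + 8 * (Fintype.card ι : ℝ) * (Fintype.card κ : ℝ) ^ 2 * K
    with hccdef
  have hc0 : 0 ≤ cc := by positivity
  have h1 := vecPicard_dist_le hW hK hb hσ hXp hXc hJX hXs T m T le_rfl
  rw [vecPicard_const_eq (ι := ι) (κ := κ) hK, ← hccdef] at h1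
  refine h1.trans ?_
  rw [mul_assoc, mul_assoc]
  refine mul_le_mul' le_rfl ?_
  rw [← ENNReal.ofReal_pow hc0, ← ENNReal.ofReal_mul (pow_nonneg hc0 m)]
  have h16 : ((1 : ℝ≥0∞) / 16) ^ m = ENNReal.ofReal ((1 / 16) ^ m) := by
    rw [ENNReal.ofReal_pow (by norm_num), ENNReal.ofReal_div_of_pos (by norm_num)]
    simp
  rw [h16, ← ENNReal.ofReal_mul (Real.exp_nonneg _)]
  refine ENNReal.ofReal_le_ofReal ?_
  have key := Real.pow_div_factorial_le_exp (x := 16 * (cc * T)) (by positivity) m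
  calc cc ^ m * ((T : ℝ) ^ m / m.factorial) = (16 * (cc * T)) ^ m / m.factorial * (1 / 16) ^ m := by
        rw [mul_pow, mul_pow, div_pow, one_pow]
        field_simp
    _ ≤ Real.exp (16 * (cc * T)) * (1 / 16) ^ m := mul_le_mul_of_nonneg_right key (by positivity)

/-- **Almost sure geometric convergence of the Picard increments** on bounded intervals: by Markov's
inequality and Borel–Cantelli, almost surely, for every `T ∈ ℕ`, eventually
`sup_{s≤T} Σ_i (Xᵐ_i(s) − Xᵐ⁺¹_i(s))² < 4⁻ᵐ`. Port of `ae_eventually_iSup_picard_lt`. [folklore] -/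
theorem vecPicard_ae_eventually_iSup_lt :
    ∀ᵐ ω ∂P, ∀ T : ℕ, ∀ᶠ m in atTop,
      ⨆ s ∈ Set.Iic (T : ℝ≥0), ENNReal.ofReal (∑ i, (X m i s ω - X (m + 1) i s ω) ^ 2) < (1 / 4) ^ m := by
  rw [ae_all_iff]
  intro T
  have hmeas : ∀ m, AEMeasurable (fun ω => ⨆ s ∈ Set.Iic (T : ℝ≥0),
      ENNReal.ofReal (∑ i, (X m i s ω - X (m + 1) i s ω) ^ 2)) P := fun m =>
    vecPicard_aemeasurable_biSup (hXp m) (hXp (m + 1)) (hXc m) (hXc (m + 1)) _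
  set D' : ℝ≥0∞ := (∫⁻ ω, ⨆ s ∈ Set.Iic (T : ℝ≥0), ENNReal.ofReal (∑ i, (X 0 i s ω - X 1 i s ω) ^ 2) ∂P) *
    ENNReal.ofReal (Real.exp (16 * (((Fintype.card ι : ℝ) * (2 * ((T : ℝ≥0) : ℝ) * K) +
      8 * (Fintype.card ι : ℝ) * (Fintype.card κ : ℝ) ^ 2 * K) * ((T : ℝ≥0) : ℝ)))) with hD'
  have hD'fin : D' ≠ ∞ := ENNReal.mul_ne_top (vecPicard_dist_zero_lt_top hW hK hσ hX0 hJX hXs T).ne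
    ENNReal.ofReal_ne_top
  have h16 : ∀ m : ℕ, ((1 : ℝ≥0∞) / 16) ^ m = (1 / 4) ^ m * (1 / 4) ^ m := by
    intro m
    have : ((1 : ℝ≥0∞) / 4) * (1 / 4) = 1 / 16 := by
      norm_num [div_eq_mul_inv, ← ENNReal.mul_inv]
    rw [← mul_pow, this]
  have h4 : ∀ m : ℕ, ((1 : ℝ≥0∞) / 4) ^ m ≠ 0 := fun m => pow_ne_zero _ (by norm_num)
  have h4' : ∀ m : ℕ, ((1 : ℝ≥0∞) / 4) ^ m ≠ ∞ := fun m =>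
    ENNReal.pow_ne_top (ENNReal.div_ne_top ENNReal.one_ne_top (by norm_num))
  have hmarkov : ∀ m, P {ω | ((1 : ℝ≥0∞) / 4) ^ m ≤ ⨆ s ∈ Set.Iic (T : ℝ≥0),
      ENNReal.ofReal (∑ i, (X m i s ω - X (m + 1) i s ω) ^ 2)} ≤ D' * (1 / 4) ^ m := by
    intro m
    have h := mul_meas_ge_le_lintegral₀ (hmeas m) (((1 : ℝ≥0∞) / 4) ^ m)
    have h3 := h.trans ((vecPicard_dist_le_geometric hW hK hb hσ hXp hXc hJX hXs T m).trans_eq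
      (show D' * (1 / 16) ^ m = (1 / 4) ^ m * (D' * (1 / 4) ^ m) by rw [h16]; ring))
    exact (ENNReal.mul_le_mul_iff_right (h4 m) (h4' m)).1 h3
  have hsum : ∑' m, P {ω | ((1 : ℝ≥0∞) / 4) ^ m ≤ ⨆ s ∈ Set.Iic (T : ℝ≥0),
      ENNReal.ofReal (∑ i, (X m i s ω - X (m + 1) i s ω) ^ 2)} ≠ ∞ := by
    refine ne_top_of_le_ne_top ?_ (ENNReal.tsum_le_tsum hmarkov)
    rw [ENNReal.tsum_mul_left, ENNReal.tsum_geometric]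
    refine ENNReal.mul_ne_top hD'fin (ENNReal.inv_ne_top.2 ?_)
    exact (tsub_pos_iff_lt.2 (by norm_num)).ne'
  filter_upwards [ae_eventually_notMem hsum] with ω hω
  refine hω.mono fun m hm => ?_
  simpa only [Set.mem_setOf_eq, not_le] using hm

end Sequence

end Summit.QuantumFields.YangMills.Theorems.ColdStartUniversality

end
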